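import Mathlib
import HarnessLib
import Summits.HubbardSuperconductivity.HubbardSuperconductivity.Theorems.KLProgrammeH10TwoPointLimitKlAnisoAnchoredSectorCountWindow
import Summits.HubbardSuperconductivity.HubbardSuperconductivity.Theorems.KLProgrammeKLRegimeKernelNormsLevelsDefs

/-!
# Route `KLProgramme` — K3 engine child `KLRegimeEngineV17F2` (stmt-HubbardSuperconductivity-20437), stub (b) import ι₂:
# the log-free anchored anisotropic sector count in the `prescribedTuples` vocabulary of the levels track

Cell gate-hubbard-kl, plan g17 (R41)(i) «E1-P2-THIN-COUNT» (seat p4, g10): the deliverable `card_bgmSectorSet_klAniso_anchored_le_linear_window`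
(`…KlAnisoAnchoredSectorCountWindow`) read for PARTIAL PRESCRIPTIONS `Ωe : Fin 4 → Option (SectorLeg N)` (`…KernelNormsLevelsDefs`): as soon as ONE
leg is prescribed (`Ωe p = some s`), `prescribedTuples (bgmSectorSet L M (klAnisoFamily L M β μ K klE0 n) 4) Ωe` is contained in the anchored set
`{Ω : Ω p = s}` and hence has `≤ C · sectorCount n` elements — the `F ≥ 1` row of the level counts with NO `|h|` factor (the `F ≥ 3` gain
`2^{-n}` of BGM 2006 Lemma 2.5 (2.98) is a different statement, not claimed here).

* `prescribedTuples_subset_filter_of_eq_some`, **`card_prescribedTuples_bgmSectorSet_klAniso_le_window`**.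

Everything is PROVED; no definitions.  References: BGM 2006 §2.8 (2.73), (2.76)–(2.80), Lemma 2.5 (2.98), Lemma 3.1 [cite: BenfattoGiulianiMastropietro2006];
Mastropietro 2008 (14.67) [cite: Mastropietro2008].
-/

noncomputable section

namespace Summit.HubbardSuperconductivity.HubbardSuperconductivity.Theorems.PerturbedFermiCurve

set_option linter.dupNamespace false -- summit = problem name (single-conjunct summit), D-0017

open Classical
open Real Set Finset
open Literature.MathematicalPhysics.QuantumLattice Literature.MathematicalPhysics.QuantumLattice.BandSectorCounting
open Literature.Probability.LatticeModels
open Summit.HubbardSuperconductivity.HubbardSuperconductivity.Theorems.DispersionFlow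
open Summit.HubbardSuperconductivity.HubbardSuperconductivity.Theorems.KLRegimeSplit
open Summit.HubbardSuperconductivity.HubbardSuperconductivity.Theorems.KLProgrammeLegKernels

/-- A prescription fixing leg `p` to `s` keeps only tuples of the anchored set `{Ω : Ω p = s}`. [folklore] -/
theorem prescribedTuples_subset_filter_of_eq_some {N m : ℕ} (A : Finset (Fin m → SectorLeg N)) {Ωe : Fin m → Option (SectorLeg N)}
    {p : Fin m} {s : SectorLeg N} (h : Ωe p = some s) :
    prescribedTuples A Ωe ⊆ A.filter (fun Ω : Fin m → SectorLeg N => Ω p = s) := by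
  intro Ω hΩ
  rw [prescribedTuples, Finset.mem_filter] at hΩ
  rw [Finset.mem_filter]
  exact ⟨hΩ.1, hΩ.2 p s (by rw [h]; exact Option.mem_some_iff.mpr rfl)⟩

/-- **The log-free anchored anisotropic count for partial prescriptions with at least one prescribed leg** (window `klWindowC`): there is `C > 0` and,
for every `R` with `0 ≤ R.Gfr j`, thresholds `c₃, U₀ > 0` such that for all `0 < c ≤ c₃`, `0 < U ≤ U₀`, `klBetaMin ≤ β ≤ e^{c/U²}`, `μ ∈ klWindowC`,
every frame with `FrameOK R U (nScales β) ν K`, every `L ≥ 1`, `M`, scale `n`, and every prescription `Ωe` with `Ωe p = some s` for some leg `p`: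
`#prescribedTuples (bgmSectorSet L M (klAnisoFamily L M β μ K klE0 n) 4) Ωe ≤ C · sectorCount n`.
[cite: BenfattoGiulianiMastropietro2006, §2.8 (2.73), (2.76)–(2.80), Lemma 3.1, App. A3] -/
theorem card_prescribedTuples_bgmSectorSet_klAniso_le_window :
    ∃ C : ℝ, 0 < C ∧ ∀ R : RenConsts, (∀ j, 0 ≤ R.Gfr j) →
      ∃ c₃ : ℝ, 0 < c₃ ∧ ∃ U₀ : ℝ, 0 < U₀ ∧
      ∀ c : ℝ, 0 < c → c ≤ c₃ → ∀ U : ℝ, 0 < U → U ≤ U₀ → ∀ β : ℝ, klBetaMin ≤ β → β ≤ Real.exp (c / U ^ 2) →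
      ∀ μ ∈ klWindowC, ∀ (ν : ℝ) (K : TrigPolyC4v), FrameOK R U (nScales β) ν K →
      ∀ (L M : ℕ) [NeZero L] (n : ℕ) (Ωe : Fin 4 → Option (SectorLeg (sectorCount n))) (p : Fin 4) (s : SectorLeg (sectorCount n)),
      Ωe p = some s →
      (((prescribedTuples (bgmSectorSet L M (klAnisoFamily L M β μ K klE0 n) 4) Ωe).card : ℕ) : ℝ) ≤ C * sectorCount n := by
  obtain ⟨C, hC, h⟩ := card_bgmSectorSet_klAniso_anchored_le_linear_window
  refine ⟨C, hC, fun R hR => ?_⟩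
  obtain ⟨c₃, hc₃, U₀, hU₀, h'⟩ := h R hR
  refine ⟨c₃, hc₃, U₀, hU₀, ?_⟩
  intro c hc hcle U hU hUle β hβ hβc μ hμ ν K hK L M _ n Ωe p s hps
  refine le_trans ?_ (h' c hc hcle U hU hUle β hβ hβc μ hμ ν K hK L M n p s)
  exact_mod_cast Finset.card_le_card (prescribedTuples_subset_filter_of_eq_some _ hps)

end Summit.HubbardSuperconductivity.HubbardSuperconductivity.Theorems.PerturbedFermiCurve

end
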